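import Mathlib
import HarnessLib
import Literature.MathematicalPhysics.StatisticalMechanics.CovarianceComparisonGronwall
import Literature.MathematicalPhysics.StatisticalMechanics.TorusFRDFourier

/-!
# Comparability of the Fourier multipliers of a kernel family along a segment in the coefficient
# matrix: `Re 𝒦̂_{A₀+TB}(κ) ≤ e^{KT} · Re 𝒦̂_{A₀}(κ)` ([ABKM19] Lemma 7.7, (7.74)–(7.75))

The step from the finite-range decomposition's bounds to the comparison (7.75)
`𝒞^{(q)}_{k+1} ≤ (1+ρ)𝒞^{(0)}_{k+1}` of [ABKM19] Lemma 7.7: along the segment `A_t = A₀ + tB`,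
`t ∈ [0, T]`, of coefficient matrices, the multiplier `c(t) = Re 𝒦̂_{A_t}(κ)` of a fixed mode `κ` of a
kernel family `A ↦ 𝒦_A` (one scale of the decomposition) is differentiable as soon as every
real-space value `s ↦ 𝒦_{A_t + sB}(x)` is (clause (iv) of `GradientFRD.TorusFRD`), its derivative is
the real part of the `s`-derivative at `s = 0` of `s ↦ 𝒦̂_{A_t+sB}(κ)` (clause (v), `ℓ = 1`, bounds its
norm by `upper`), and with the LOWER shell bound `lower ≤ Re 𝒦̂_{A_t}(κ)` and the ratio
`upper ≤ K · lower` (`CovarianceComparisonShellRatio`) the Grönwall step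
(`CovarianceComparisonGronwall`) gives `c(T) ≤ e^{KT} c(0)`:

* `hasDerivAt_fourierCoeff_segment` — differentiability of `t ↦ 𝒦̂_{A₀+tB}(κ)` from that of the
  real-space values, with derivative `deriv (s ↦ 𝒦̂_{A₀+tB+sB}(κ)) 0`;
* **`re_fourierCoeff_segment_le_exp_mul`** — `Re 𝒦̂_{A₀+TB}(κ) ≤ exp (K T) · Re 𝒦̂_{A₀}(κ)`;
* `re_fourierCoeff_segment_le_one_add_mul` — `≤ (1+ρ) · Re 𝒦̂_{A₀}(κ)` for `K T ≤ log (1+ρ)`.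

Everything is proved; no named fact.  Not here: discharging the three hypotheses from
`GradientFRD.TorusFRD_holds` (clauses (iv), (v)) for `𝒦 = 𝒞 L N M · k`, `A₀ = 1`, `B = q/‖q‖`.

## References
* S. Adams, S. Buchholz, R. Kotecký, S. Müller, arXiv:1910.13564, Lemma 7.7, (7.74)–(7.75)
  [AdamsBuchholzKoteckyMuller2019].
-/

noncomputable section

namespace Literature.MathematicalPhysics.StatisticalMechanics.GradientRG

open Real Set
open Literature.MathematicalPhysics.StatisticalMechanics.GradientFRD (fourierCoeff fourierCoeff_eq_sum)
open Literature.Probability.LatticeModels (torusChar)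

variable {d M : ℕ} [NeZero M]

/-- **`t ↦ 𝒦̂_{A₀+tB}(κ)` is differentiable at `t`** when every real-space value
`s ↦ 𝒦_{A₀+tB+sB}(x)` is differentiable at `s = 0`, with derivative
`deriv (s ↦ 𝒦̂_{A₀+tB+sB}(κ)) 0` (reparametrisation `s = u − t` of a finite Fourier sum).
[cite: AdamsBuchholzKoteckyMuller2019, Lemma 7.7 (7.74)] -/
theorem hasDerivAt_fourierCoeff_segment {𝒦 : Matrix (Fin d) (Fin d) ℝ → (Fin d → ZMod M) → ℝ}
    {A₀ B : Matrix (Fin d) (Fin d) ℝ} {t : ℝ} (κ : Fin d → ZMod M)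
    (hdiff : ∀ x, DifferentiableAt ℝ (fun s : ℝ => 𝒦 (A₀ + t • B + s • B) x) 0) :
    HasDerivAt (fun u : ℝ => fourierCoeff (𝒦 (A₀ + u • B)) κ)
      (deriv (fun s : ℝ => fourierCoeff (𝒦 (A₀ + t • B + s • B)) κ) 0) t := by
  set G : ℝ → ℂ := fun s => fourierCoeff (𝒦 (A₀ + t • B + s • B)) κ with hG
  -- `G` is differentiable at `0`: a finite sum of differentiable terms
  have hGd : HasDerivAt G (∑ x : Fin d → ZMod M,
      ((deriv (fun s : ℝ => 𝒦 (A₀ + t • B + s • B) x) 0 : ℝ) : ℂ) * (starRingEnd ℂ) (torusChar κ x)) 0 := by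
    have hfun : G = fun s => ∑ x : Fin d → ZMod M,
        ((𝒦 (A₀ + t • B + s • B) x : ℝ) : ℂ) * (starRingEnd ℂ) (torusChar κ x) := by
      funext s; rw [hG]; exact fourierCoeff_eq_sum _ κ
    rw [hfun]
    refine HasDerivAt.fun_sum fun x _ => ?_
    exact ((hdiff x).hasDerivAt.ofReal_comp).mul_const _
  have hG0 : HasDerivAt G (deriv G 0) 0 := hGd.differentiableAt.hasDerivAt
  -- reparametrise: `u ↦ G (u − t)` is the segment function
  set sh : ℝ → ℝ := fun u => u - t with hsh
  have hsub : HasDerivAt sh 1 t := (hasDerivAt_id t).sub_const t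
  have hsh0 : sh t = 0 := sub_self t
  have hG0' : HasDerivAt G (deriv G 0) (sh t) := by rw [hsh0]; exact hG0
  have hcomp : HasDerivAt (G ∘ sh) ((1 : ℝ) • deriv G 0) t := hG0'.scomp t hsub
  have hfun : (G ∘ sh) = fun u : ℝ => fourierCoeff (𝒦 (A₀ + u • B)) κ := by
    funext u
    simp only [Function.comp_apply, hG, hsh]
    congr 2
    rw [add_assoc, ← add_smul, add_sub_cancel]
  rw [hfun, one_smul] at hcomp
  exact hcomp

/-- **`Re 𝒦̂_{A₀+TB}(κ) ≤ exp (K T) · Re 𝒦̂_{A₀}(κ)`** ([ABKM19] (7.74)–(7.75) along a segment): if for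
every `t ∈ [0, T]` the real-space values `s ↦ 𝒦_{A₀+tB+sB}(x)` are differentiable at `0`, the
`s`-derivative of the multiplier at `0` has norm `≤ upper`, the multiplier has the lower bound
`lower ≤ Re 𝒦̂_{A₀+tB}(κ)`, and `upper ≤ K · lower` with `K ≥ 0`.
[cite: AdamsBuchholzKoteckyMuller2019, Lemma 7.7 (7.75)] -/
theorem re_fourierCoeff_segment_le_exp_mul {𝒦 : Matrix (Fin d) (Fin d) ℝ → (Fin d → ZMod M) → ℝ}
    {A₀ B : Matrix (Fin d) (Fin d) ℝ} {T K lower upper : ℝ} (hT : 0 ≤ T) (κ : Fin d → ZMod M)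
    (hdiff : ∀ t ∈ Icc 0 T, ∀ x, DifferentiableAt ℝ (fun s : ℝ => 𝒦 (A₀ + t • B + s • B) x) 0)
    (hup : ∀ t ∈ Icc 0 T, ‖deriv (fun s : ℝ => fourierCoeff (𝒦 (A₀ + t • B + s • B)) κ) 0‖ ≤ upper)
    (hlow : ∀ t ∈ Icc 0 T, lower ≤ (fourierCoeff (𝒦 (A₀ + t • B)) κ).re)
    (hK : 0 ≤ K) (hratio : upper ≤ K * lower) :
    (fourierCoeff (𝒦 (A₀ + T • B)) κ).re ≤ exp (K * T) * (fourierCoeff (𝒦 A₀) κ).re := by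
  set c : ℝ → ℝ := fun u => (fourierCoeff (𝒦 (A₀ + u • B)) κ).re with hc
  set c' : ℝ → ℝ := fun u => (deriv (fun s : ℝ => fourierCoeff (𝒦 (A₀ + u • B + s • B)) κ) 0).re
    with hc'
  have hder : ∀ u ∈ Icc 0 T, HasDerivAt c (c' u) u := by
    intro u hu
    have h := hasDerivAt_fourierCoeff_segment (𝒦 := 𝒦) (A₀ := A₀) (B := B) κ (hdiff u hu)
    have h2 := Complex.reCLM.hasFDerivAt.comp_hasDerivAt u h
    convert h2 using 1 <;> rfl
  have hb : ∀ u ∈ Icc 0 T, |c' u| ≤ K * c u := by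
    intro u hu
    have h1 : |c' u| ≤ upper := (Complex.abs_re_le_norm _).trans (hup u hu)
    exact abs_deriv_le_ratio_mul_of_shell_bounds' hK (hlow u hu) h1 hratio
  have h := le_exp_mul_of_abs_deriv_le hT hder hb
  have h0 : c 0 = (fourierCoeff (𝒦 A₀) κ).re := by simp [hc]
  have h1 : c T = (fourierCoeff (𝒦 (A₀ + T • B)) κ).re := rfl
  rw [h0, h1] at h
  exact h
where
  /-- `|c'| ≤ K · re` from `lower ≤ re`, `|c'| ≤ upper ≤ K · lower`, `K ≥ 0`.
  [cite: AdamsBuchholzKoteckyMuller2019, Lemma 7.7 (7.74)] -/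
  abs_deriv_le_ratio_mul_of_shell_bounds' {c' re lower upper K : ℝ} (hK : 0 ≤ K)
      (hlow : lower ≤ re) (hup : |c'| ≤ upper) (hratio : upper ≤ K * lower) : |c'| ≤ K * re :=
    hup.trans (hratio.trans (mul_le_mul_of_nonneg_left hlow hK))

/-- **The `(1+ρ)` form** ([ABKM19] (7.75)): under the same hypotheses and `K T ≤ log (1+ρ)`,
`0 ≤ lower`: `Re 𝒦̂_{A₀+TB}(κ) ≤ (1+ρ) · Re 𝒦̂_{A₀}(κ)`.
[cite: AdamsBuchholzKoteckyMuller2019, Lemma 7.7 (7.75)] -/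
theorem re_fourierCoeff_segment_le_one_add_mul {𝒦 : Matrix (Fin d) (Fin d) ℝ → (Fin d → ZMod M) → ℝ}
    {A₀ B : Matrix (Fin d) (Fin d) ℝ} {T K lower upper ρ : ℝ} (hT : 0 ≤ T) (κ : Fin d → ZMod M)
    (hdiff : ∀ t ∈ Icc 0 T, ∀ x, DifferentiableAt ℝ (fun s : ℝ => 𝒦 (A₀ + t • B + s • B) x) 0)
    (hup : ∀ t ∈ Icc 0 T, ‖deriv (fun s : ℝ => fourierCoeff (𝒦 (A₀ + t • B + s • B)) κ) 0‖ ≤ upper)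
    (hlow : ∀ t ∈ Icc 0 T, lower ≤ (fourierCoeff (𝒦 (A₀ + t • B)) κ).re)
    (hK : 0 ≤ K) (hratio : upper ≤ K * lower) (hρ : -1 < ρ) (hKT : K * T ≤ Real.log (1 + ρ))
    (hlower : 0 ≤ lower) :
    (fourierCoeff (𝒦 (A₀ + T • B)) κ).re ≤ (1 + ρ) * (fourierCoeff (𝒦 A₀) κ).re := by
  have h := re_fourierCoeff_segment_le_exp_mul hT κ hdiff hup hlow hK hratio
  have hexp : exp (K * T) ≤ 1 + ρ := by
    have h1 : exp (K * T) ≤ exp (Real.log (1 + ρ)) := exp_le_exp.2 hKT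
    rwa [Real.exp_log (by linarith)] at h1
  have hc0 : 0 ≤ (fourierCoeff (𝒦 A₀) κ).re := by
    have := hlow 0 (left_mem_Icc.2 hT)
    rw [zero_smul, add_zero] at this
    exact hlower.trans this
  exact h.trans (mul_le_mul_of_nonneg_right hexp hc0)

end Literature.MathematicalPhysics.StatisticalMechanics.GradientRG

end
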